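import Summits.Ventures.Crystal3D.Theorems.StickyWulffConstantPolycrystalWulffBoundAggLP
import Summits.Ventures.Crystal3D.Theorems.StickyWulffConstantPolycrystalWulffBoundAggStaticRows
import Summits.Ventures.Crystal3D.Theorems.StickyWulffConstantPolycrystalWulffBoundAggPrelim
import Summits.Ventures.Crystal3D.Theorems.StickyWulffConstantPolycrystalWulffBoundAllClassesInduction

/-!
# `PolycrystalWulffBound`, line `PolyDensity`: the aggregated step — ALL twin-free polyhedral textures

Route `StickyWulffConstant` of the venture `Summits/Ventures/Crystal3D`, crux `PolycrystalWulffBound`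
(item `stmt-Ventures-19482`), second prover lane (poly-p2, gen 7).  `aggStep_of_AggCert`: the STEP hypothesis
of `rung_twinFree_allClasses_of_step` — a twin-free polyhedral texture with at least four lattice classes and no
class above `17/20` of the volume obeys the polycrystal Wulff bound, given the bound for every twin-free
polyhedral texture on the same index set with fewer classes — follows from the two computational hypotheses
CH-P1′ (`∀ R, 27.8 ≤ |W(1) ∩ W(R)|`, by value) and CH-P3 (`AggCert27_8`).  Bridge: classes = the finite type of
lattices `A f '' Λ` present; bodies `W(A (rep ℓ))`; class variables and generic static rows from
`aggStaticRows`; walls from `walls_ge_crossClass`; recolour / delete rows (the induction hypothesis) from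
`rec_row_classes` / `del_row_classes`; the three largest classes from `exists_top_three`; then `aggLP_bound`.
Corollary `rung_twinFree_allClasses_of_AggCert : AggCert27_8 → WulffOverlap27_8 → ` the polycrystal Wulff
bound for EVERY twin-free polyhedral texture (any number of grains and lattices).
WHAT THIS IS NOT: twinned textures (co-axial pairs of distinct lattices), non-polyhedral grains, or a
discharge of CH-P1′ / CH-P3 (kit-certified resp. float-certified, see `…WulffOverlapHyps`, `…AggCertDef`);
F-C1 not moved.
-/

noncomputable section

open scoped BigOperators InnerProductSpace ENNReal
open MeasureTheory Filter

namespace Summit.Ventures.Crystal3D.Cruxes.PolycrystalWulffBound.PolyDensity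

open Summit.Ventures.Crystal3D.Theorems
open Summit.Ventures.Crystal3D.Cruxes.TextureLiminf.TexShadow (per polytope E3)
open Literature.MathematicalPhysics.StatisticalMechanics (perimeter)

set_option maxHeartbeats 4000000 in  -- one long bridge proof (let-telescope conversions)
/-- **The aggregated step from CH-P1′ and CH-P3.**  See the module docstring. -/
theorem aggStep_of_AggCert (hC : AggCert27_8) :

    let Λ : Set (EuclideanSpace ℝ (Fin 3)) := Literature.MathematicalPhysics.StatisticalMechanics.fccStacking 1 (Real.sqrt (2 / 3));
    let Brl : (ℤ → ℤ) → Set (EuclideanSpace ℝ (Fin 3)) := Literature.MathematicalPhysics.StatisticalMechanics.barlowStacking 1 (Real.sqrt (2 / 3));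
    let Ax : EuclideanSpace ℝ (Fin 3) → (EuclideanSpace ℝ (Fin 3) ≃ₗᵢ[ℝ] EuclideanSpace ℝ (Fin 3)) → (EuclideanSpace ℝ (Fin 3) ≃ₗᵢ[ℝ] EuclideanSpace ℝ (Fin 3)) → Prop := fun m A B => ∃ (L : EuclideanSpace ℝ (Fin 3) ≃ₗᵢ[ℝ] EuclideanSpace ℝ (Fin 3)) (s₁ s₂ : EuclideanSpace ℝ (Fin 3)) (σ σ' : ℤ → ℤ), Literature.MathematicalPhysics.StatisticalMechanics.IsHaggSeq σ ∧ Literature.MathematicalPhysics.StatisticalMechanics.IsHaggSeq σ' ∧ L (EuclideanSpace.single (2 : Fin 3) (1 : ℝ)) = m ∧ A '' Λ ⊆ (fun q => L q + s₁) '' Brl σ ∧ B '' Λ ⊆ (fun q => L q + s₂) '' Brl σ';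
    let CoAx : (EuclideanSpace ℝ (Fin 3) ≃ₗᵢ[ℝ] EuclideanSpace ℝ (Fin 3)) → (EuclideanSpace ℝ (Fin 3) ≃ₗᵢ[ℝ] EuclideanSpace ℝ (Fin 3)) → Prop := fun A B => ∃ m, Ax m A B;
    let Φ : EuclideanSpace ℝ (Fin 3) → ℝ := fun ν => Real.sqrt 2 / 4 * ∑ᶠ w ∈ {w ∈ Λ | ‖w‖ = 1}, |⟪w, ν⟫_ℝ|;
    let Per : Set (EuclideanSpace ℝ (Fin 3)) → Set (EuclideanSpace ℝ (Fin 3)) → ℝ := fun K S => (⨆ (ξ : EuclideanSpace ℝ (Fin 3) → EuclideanSpace ℝ (Fin 3)) (_ : ContDiff ℝ 1 ξ ∧ HasCompactSupport ξ ∧ ∀ z, ξ z ∈ K), ENNReal.ofReal (∫ z in S, Literature.MathematicalPhysics.StatisticalMechanics.fieldDivergence ξ z)).toReal;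
    let ι : Set (EuclideanSpace ℝ (Fin 3)) → Set (EuclideanSpace ℝ (Fin 3)) → Set (EuclideanSpace ℝ (Fin 3)) → ℝ := fun K S₁ S₂ => (Per K S₁ + Per K S₂ - Per K (S₁ ∪ S₂)) / 2;
    let W : (EuclideanSpace ℝ (Fin 3) ≃ₗᵢ[ℝ] EuclideanSpace ℝ (Fin 3)) → Set (EuclideanSpace ℝ (Fin 3)) := fun A => {y | ∀ ν : EuclideanSpace ℝ (Fin 3), ⟪y, ν⟫_ℝ ≤ Φ (A.symm ν)};
    let Dsc : EuclideanSpace ℝ (Fin 3) → Set (EuclideanSpace ℝ (Fin 3)) := fun m => {y | ‖y‖ ≤ 1 ∧ ⟪y, m⟫_ℝ = 0};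
    let Tex : (n : ℕ) → (Fin n → Set (EuclideanSpace ℝ (Fin 3))) → (Fin n → (EuclideanSpace ℝ (Fin 3) ≃ₗᵢ[ℝ] EuclideanSpace ℝ (Fin 3))) → (Fin n → Fin n → ℝ) → (Fin n → Fin n → EuclideanSpace ℝ (Fin 3)) → Prop := fun n G A c m => (∀ f : Fin n, Literature.MathematicalPhysics.StatisticalMechanics.HasFinitePerimeter (G f) ∧ volume (G f) < ⊤) ∧ (∀ f g, f ≠ g → Disjoint (G f) (G g)) ∧ (∀ f g, f ≠ g → 0 ≤ c f g) ∧ (∀ f g, f ≠ g → ¬ CoAx (A f) (A g) → m f g = 0 ∧ 1 ≤ c f g) ∧ (∀ f g, f ≠ g → CoAx (A f) (A g) → A f '' Λ ≠ A g '' Λ → Ax (m f g) (A f) (A g) ∧ 1 / 2 ≤ c f g);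
    let En : (n : ℕ) → (Fin n → Set (EuclideanSpace ℝ (Fin 3))) → (Fin n → (EuclideanSpace ℝ (Fin 3) ≃ₗᵢ[ℝ] EuclideanSpace ℝ (Fin 3))) → (Fin n → Fin n → ℝ) → (Fin n → Fin n → EuclideanSpace ℝ (Fin 3)) → ℝ := fun n G A c m => ∑ f : Fin n, Per (W (A f)) (G f) - ∑ f, ∑ g, (if f = g then 0 else ι (W (A f)) (G f) (G g)) + ∑ f, ∑ g, (if f = g then 0 else c f g / 2 * ι (Dsc (m f g)) (G f) (G g));
    let Vol : (n : ℕ) → (Fin n → Set (EuclideanSpace ℝ (Fin 3))) → ℝ := fun n G => (volume (⋃ f : Fin n, G f)).toReal;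
    let Poly : Set (EuclideanSpace ℝ (Fin 3)) → Prop := fun S => ∃ (k : ℕ) (H : Fin k → Finset ((EuclideanSpace ℝ (Fin 3)) × ℝ)), S = ⋃ i, ⋂ p ∈ H i, {x | ⟪p.1, x⟫_ℝ < p.2};
    let TF : (n : ℕ) → (Fin n → (EuclideanSpace ℝ (Fin 3) ≃ₗᵢ[ℝ] EuclideanSpace ℝ (Fin 3))) → Prop := fun n A => ∀ f g : Fin n, f ≠ g → CoAx (A f) (A g) → A f '' Λ = A g '' Λ;
    (∀ R : EuclideanSpace ℝ (Fin 3) ≃ₗᵢ[ℝ] EuclideanSpace ℝ (Fin 3), (27.8 : ℝ) ≤ (volume (W (LinearIsometryEquiv.refl ℝ (EuclideanSpace ℝ (Fin 3))) ∩ W R)).toReal) →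
      ∀ (n : ℕ) (G : Fin n → Set (EuclideanSpace ℝ (Fin 3))) (A : Fin n → (EuclideanSpace ℝ (Fin 3) ≃ₗᵢ[ℝ] EuclideanSpace ℝ (Fin 3))) (c : Fin n → Fin n → ℝ) (m : Fin n → Fin n → EuclideanSpace ℝ (Fin 3)),
        Tex n G A c m → (∀ f, Poly (G f)) → TF n A →
        (∀ f₀ : Fin n, (volume (⋃ g ∈ {g : Fin n | A g '' Λ = A f₀ '' Λ}, G g)).toReal < 17 / 20 * Vol n G) →
        4 ≤ (Finset.univ.image fun f => A f '' Λ).card →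
        (∀ (G' : Fin n → Set (EuclideanSpace ℝ (Fin 3))) (A' : Fin n → (EuclideanSpace ℝ (Fin 3) ≃ₗᵢ[ℝ] EuclideanSpace ℝ (Fin 3))) (c' : Fin n → Fin n → ℝ) (m' : Fin n → Fin n → EuclideanSpace ℝ (Fin 3)),
          Tex n G' A' c' m' → (∀ f, Poly (G' f)) → TF n A' →
          (Finset.univ.image fun f => A' f '' Λ).card < (Finset.univ.image fun f => A f '' Λ).card →
          6 * (2 : ℝ) ^ ((1 : ℝ) / 3) * (Real.sqrt 2 * Vol n G') ^ ((2 : ℝ) / 3) ≤ En n G' A' c' m') →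
        6 * (2 : ℝ) ^ ((1 : ℝ) / 3) * (Real.sqrt 2 * Vol n G) ^ ((2 : ℝ) / 3) ≤ En n G A c m := by
  intro Λ Brl Ax CoAx Φ Per ι W Dsc Tex En Vol Poly TF hOv n G A c m hTex hPoly hTF hdom h4 hIH
  classical
  obtain ⟨hfin, hdisj, hc0, hgen, hco⟩ := hTex
  set lat : Fin n → Set E3 := fun f => A f '' Λ with hlat
  -- the finite type of classes
  set L : Finset (Set E3) := Finset.univ.image lat with hL
  have hcls_mem : ∀ f, lat f ∈ L := fun f => Finset.mem_image_of_mem lat (Finset.mem_univ f)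
  set cls : Fin n → ↥L := fun f => ⟨lat f, hcls_mem f⟩ with hcls
  have hcls_iff : ∀ f g : Fin n, cls f = cls g ↔ A f '' Λ = A g '' Λ := by
    intro f g
    simp only [hcls, Subtype.mk.injEq, hlat]
  have hrep_ex : ∀ i : ↥L, ∃ f, lat f = i.1 := fun i => by
    obtain ⟨f, -, hf⟩ := Finset.mem_image.1 i.2
    exact ⟨f, hf⟩
  choose rep hrep using hrep_ex
  have hcls_rep_eq : ∀ i, cls (rep i) = i := fun i => Subtype.ext (hrep i)
  have hcls_rep : ∀ f, lat f = lat (rep (cls f)) := fun f => (hrep (cls f)).symm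
  have hcardβ : Fintype.card ↥L = L.card := Fintype.card_coe L
  -- bodies
  set KC : ↥L → Set E3 := fun i => W (A (rep i)) with hKC
  have hWcls : ∀ f, W (A f) = KC (cls f) := fun f => wulffBody_eq_of_image_eq (hcls_rep f)
  have hKc : ∀ i, IsCompact (KC i) := fun i => isCompact_cruxWulffBody _
  have hKv : ∀ i, Convex ℝ (KC i) := fun i => convex_cruxWulffBody _
  have hK0 : ∀ i, (0 : E3) ∈ KC i := fun i => zero_mem_cruxWulffBody _
  have hKs : ∀ i, -KC i = KC i := fun i => neg_cruxWulffBody_eq _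
  have hK3 : ∀ i, Metric.closedBall (0 : E3) (Real.sqrt 3) ⊆ KC i := fun i =>
    closedBall_subset_cruxWulffBody _
  have hK5 : ∀ i, KC i ⊆ Metric.closedBall (0 : E3) (Real.sqrt 5) := fun i =>
    cruxWulffBody_subset_closedBall _
  have hvolK : ∀ i, (volume (KC i)).toReal = 32 := by
    intro i; show (volume (W (A (rep i)))).toReal = 32
    rw [volume_cruxWulffBody]; simp
  have hpair : ∀ i j, (27.8 : ℝ) ≤ (volume (KC i ∩ KC j)).toReal := by
    intro i j
    set I : EuclideanSpace ℝ (Fin 3) ≃ₗᵢ[ℝ] EuclideanSpace ℝ (Fin 3) :=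
      LinearIsometryEquiv.refl ℝ (EuclideanSpace ℝ (Fin 3)) with hI
    set R : EuclideanSpace ℝ (Fin 3) ≃ₗᵢ[ℝ] EuclideanSpace ℝ (Fin 3) :=
      (A (rep j)).trans (A (rep i)).symm with hR
    have h1 : W (A (rep i)) = A (rep i) '' W I := cruxWulffBody_eq_image_self (A (rep i))
    have h2 : W (A (rep j)) = A (rep j) '' W I := cruxWulffBody_eq_image_self (A (rep j))
    have h3 : W R = R '' W I := cruxWulffBody_eq_image_self R
    have hcomp : (A (rep i) : EuclideanSpace ℝ (Fin 3) → EuclideanSpace ℝ (Fin 3)) ∘ R = A (rep j) := by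
      ext x; simp [hR]
    have hset : W (A (rep i)) ∩ W (A (rep j)) = A (rep i) '' (W I ∩ W R) := by
      rw [Set.image_inter (A (rep i)).injective, ← h1, h3, ← Set.image_comp, hcomp, ← h2]
    have hmeas : MeasurableSet (W I ∩ W R) :=
      ((isCompact_cruxWulffBody I).inter (isCompact_cruxWulffBody R)).measurableSet
    have hv : volume (W (A (rep i)) ∩ W (A (rep j))) = volume (W I ∩ W R) := by
      rw [hset, LinearIsometryEquiv.image_eq_preimage_symm,
        (A (rep i)).symm.measurePreserving.measure_preimage hmeas.nullMeasurableSet]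
    show (27.8 : ℝ) ≤ (volume (W (A (rep i)) ∩ W (A (rep j)))).toReal
    rw [hv]; exact hOv R
  have hshave : ∀ i (K : Set E3), K ⊆ KC i → ∀ ε : ℝ, 0 < ε → ε ≤ 5 →
      (volume K).toReal - 8 * ε ^ 3 ≤ (volume (K ∩ Metric.closedBall (0 : E3) (Real.sqrt (5 - ε)))).toReal :=
    fun i K hK ε hε hε5 => toReal_volume_inter_closedBall_ge (A (rep i)) hK hε hε5
  -- class variables and the generic static rows
  obtain ⟨F, Y, Acl, v, hFdef, hYdef, hAcldef, hvdef, hV, -, hv_nn, hF_nn, hY_nn, hAcl_nn, hAcl_symm, hfloor,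
    hshv_single, hshv_pair, hsingle0, hpair0, htriple0, hballP, hisoP, hsumP, hsumP0⟩ :=
    aggStaticRows G hfin hPoly hdisj cls KC hKc hKv hK0 hKs hK3 hK5 hvolK hpair hshave
  set C : ↥L → Finset (Fin n) := fun i => Finset.univ.filter (fun f => cls f = i) with hCdef
  -- the three largest classes
  have h3 : 3 ≤ Fintype.card ↥L := by rw [hcardβ]; exact le_trans (by norm_num) h4
  obtain ⟨a, b, d, hab, hbd, had, hvba, hvdb, htop'⟩ := exists_top_three v h3
  have htop : ∀ r ∈ Finset.univ \ ({a, b, d} : Finset ↥L), v r ≤ v d := by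
    intro r hr
    simp only [Finset.mem_sdiff, Finset.mem_univ, true_and, Finset.mem_insert, Finset.mem_singleton,
      not_or] at hr
    exact htop' r hr.1 hr.2.1 hr.2.2
  have hT : (Finset.univ \ ({a, b, d} : Finset ↥L)).Nonempty := by
    rw [Finset.nonempty_iff_ne_empty, Ne, Finset.sdiff_eq_empty_iff_subset]
    intro hsub
    have h1 := Finset.card_le_card hsub
    have h2 : ({a, b, d} : Finset ↥L).card ≤ 3 := Finset.card_le_three
    rw [Finset.card_univ, hcardβ] at h1
    omega
  -- volumes
  have hVsplit : Vol n G = v a + v b + v d + ∑ r ∈ Finset.univ \ {a, b, d}, v r := by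
    show (volume (⋃ f, G f)).toReal = _
    rw [hV, sum_univ_split_three hab hbd had v]
  have hva : v a = (volume (⋃ g ∈ {g : Fin n | A g '' Λ = A (rep a) '' Λ}, G g)).toReal := by
    rw [hvdef]
    show (volume (⋃ f ∈ Finset.univ.filter (fun f => cls f = a), G f)).toReal = _
    have hset : (⋃ f ∈ Finset.univ.filter (fun f => cls f = a), G f) =
        ⋃ g ∈ {g : Fin n | A g '' Λ = A (rep a) '' Λ}, G g := by
      ext x
      simp only [Set.mem_iUnion, Set.mem_setOf_eq, Finset.mem_filter, Finset.mem_univ, true_and]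
      constructor
      · rintro ⟨f, hf, hx⟩
        exact ⟨f, (hcls_iff f (rep a)).1 (hf.trans (hcls_rep_eq a).symm), hx⟩
      · rintro ⟨f, hf, hx⟩
        exact ⟨f, ((hcls_iff f (rep a)).2 hf).trans (hcls_rep_eq a), hx⟩
    rw [hset]
  have hdom' : v a ≤ 17 / 20 * Vol n G := by rw [hva]; exact (hdom (rep a)).le
  have hVpos : 0 < Vol n G := by
    rcases (show (0 : ℝ) ≤ Vol n G from ENNReal.toReal_nonneg).eq_or_lt with h | h
    · exfalso
      have h0 := hdom (rep a)
      rw [← h, mul_zero] at h0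
      exact (not_le.2 h0) ENNReal.toReal_nonneg
    · exact h
  -- walls and the energy row
  have hAclij : ∀ i j, (∑ f ∈ C i, ∑ g ∈ C j, ι (Metric.closedBall (0 : EuclideanSpace ℝ (Fin 3)) 1) (G f) (G g)) = Acl i j := by
    intro i j; rw [hAcldef]; rfl
  have hwalls := walls_ge_crossClass n G A c m ↥L cls ⟨hfin, hdisj, hc0, hgen, hco⟩ hPoly hTF hcls_iff
  have hcross : (∑ f, ∑ g, (if cls f ≠ cls g then ι (Metric.closedBall (0 : EuclideanSpace ℝ (Fin 3)) 1) (G f) (G g) / 2 else 0)) =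
      ∑ i : ↥L, ∑ j : ↥L, (if i ≠ j then Acl i j / 2 else 0) := by
    have h1 : (∑ f, ∑ g, (if cls f ≠ cls g then ι (Metric.closedBall (0 : EuclideanSpace ℝ (Fin 3)) 1) (G f) (G g) / 2 else 0)) =
        ∑ f, ∑ g, (if f ≠ g ∧ True ∧ True ∧ cls f ≠ cls g then
          ι (Metric.closedBall (0 : EuclideanSpace ℝ (Fin 3)) 1) (G f) (G g) / 2 else 0) := by
      refine Finset.sum_congr rfl fun f _ => Finset.sum_congr rfl fun g _ => ?_
      by_cases h : cls f ≠ cls g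
      · have hfg : f ≠ g := fun e => h (by rw [e])
        rw [if_pos h, if_pos ⟨hfg, trivial, trivial, h⟩]
      · rw [if_neg h, if_neg (fun k => h k.2.2.2)]
    rw [h1, classCross_sum cls (fun f g => ι (Metric.closedBall (0 : EuclideanSpace ℝ (Fin 3)) 1) (G f) (G g)) (fun _ => True)]
    refine Finset.sum_congr rfl fun i _ => Finset.sum_congr rfl fun j _ => ?_
    rw [hAclij i j]
    simp only [true_and]
  have hFsum : (∑ f, (Per (W (A f)) (G f) - ∑ g, (if f = g then 0 else ι (W (A f)) (G f) (G g)))) = ∑ i : ↥L, F i := by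
    have hfr : ∀ f, (Per (W (A f)) (G f) - ∑ g, (if f = g then 0 else ι (W (A f)) (G f) (G g))) =
        per (KC (cls f)) (G f) - ∑ g, (if f = g then 0 else
          (per (KC (cls f)) (G f) + per (KC (cls f)) (G g) - per (KC (cls f)) (G f ∪ G g)) / 2) := by
      intro f; rw [hWcls f]; rfl
    simp only [hfr, hFdef]
    exact (Finset.sum_fiberwise_of_maps_to (s := Finset.univ) (t := Finset.univ) (g := cls)
      (fun _ _ => Finset.mem_univ _) _).symm
  have hEn : En n G A c m = (∑ i : ↥L, F i) +
      ∑ f, ∑ g, (if f = g then 0 else c f g / 2 * ι (Dsc (m f g)) (G f) (G g)) := by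
    show (∑ f, Per (W (A f)) (G f) - ∑ f, ∑ g, (if f = g then 0 else ι (W (A f)) (G f) (G g)) +
        ∑ f, ∑ g, (if f = g then 0 else c f g / 2 * ι (Dsc (m f g)) (G f) (G g))) = _
    rw [← hFsum, Finset.sum_sub_distrib]
  have hE : (∑ i : ↥L, F i) + (∑ i : ↥L, ∑ j : ↥L, (if i ≠ j then Acl i j / 2 else 0)) ≤ En n G A c m := by
    rw [hcross] at hwalls; rw [hEn]; linarith
  -- the recolouring rows (induction hypothesis)
  have hrec : ∀ (𝒮 : Finset ↥L) (l : ↥L), l ∉ 𝒮 → 𝒮.Nonempty →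
      6 * (2 : ℝ) ^ ((1 : ℝ) / 3) * (Real.sqrt 2 * Vol n G) ^ ((2 : ℝ) / 3) ≤ En n G A c m + (Real.sqrt 5 - Real.sqrt 3) * (∑ i ∈ 𝒮, Y i)
        - (∑ i, ∑ j, (if ((i ∈ insert l 𝒮) ∧ (j ∈ insert l 𝒮)) ∧ i ≠ j then Acl i j / 2 else 0)) := by
    intro 𝒮 l hl hne
    have hl' : cls (rep l) ∉ 𝒮 := by rw [hcls_rep_eq]; exact hl
    have hne' : ∃ f, cls f ∈ 𝒮 := by
      obtain ⟨i, hi⟩ := hne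
      exact ⟨rep i, by rw [hcls_rep_eq]; exact hi⟩
    have h := rec_row_classes n G A c m ↥L cls 𝒮 (rep l) ⟨hfin, hdisj, hc0, hgen, hco⟩ hPoly hTF hcls_iff hl' hne' hIH
    rw [hcls_rep_eq] at h
    have hYS : (∑ i ∈ 𝒮, (∑ f ∈ Finset.univ.filter (fun f => cls f = i),
        (Per (Metric.closedBall (0 : EuclideanSpace ℝ (Fin 3)) 1) (G f) -
          ∑ g, (if f = g then 0 else ι (Metric.closedBall (0 : EuclideanSpace ℝ (Fin 3)) 1) (G f) (G g))))) =
        ∑ i ∈ 𝒮, Y i := by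
      simp only [hYdef]; rfl
    have hAS : (∑ i, ∑ j, (if ((i ∈ insert l 𝒮) ∧ (j ∈ insert l 𝒮)) ∧ i ≠ j then
        (∑ f ∈ Finset.univ.filter (fun f => cls f = i), ∑ g ∈ Finset.univ.filter (fun g => cls g = j),
          (Per (Metric.closedBall (0 : EuclideanSpace ℝ (Fin 3)) 1) (G f) +
            Per (Metric.closedBall (0 : EuclideanSpace ℝ (Fin 3)) 1) (G g) -
            Per (Metric.closedBall (0 : EuclideanSpace ℝ (Fin 3)) 1) (G f ∪ G g)) / 2) / 2 else 0)) =
        ∑ i, ∑ j, (if ((i ∈ insert l 𝒮) ∧ (j ∈ insert l 𝒮)) ∧ i ≠ j then Acl i j / 2 else 0) := by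
      simp only [hAcldef]; rfl
    rw [hYS, hAS] at h
    exact h
  -- the deletion rows (induction hypothesis)
  have hdel : ∀ (𝒮 : Finset ↥L), 𝒮.Nonempty → (∃ l, l ∉ 𝒮) →
      6 * (2 : ℝ) ^ ((1 : ℝ) / 3) * (Real.sqrt 2 * (Vol n G - ∑ i ∈ 𝒮, v i)) ^ ((2 : ℝ) / 3) ≤
        En n G A c m - (∑ i ∈ 𝒮, F i)
        + (Real.sqrt 5 - 1) * (∑ i ∈ Finset.univ \ 𝒮, ∑ j ∈ 𝒮, Acl i j)
        - (∑ i, ∑ j, (if ((i ∈ 𝒮) ∧ (j ∈ 𝒮)) ∧ i ≠ j then Acl i j / 2 else 0)) := by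
    intro 𝒮 hne hout
    obtain ⟨l, hl⟩ := hout
    have hl' : cls (rep l) ∉ 𝒮 := by rw [hcls_rep_eq]; exact hl
    have hne' : ∃ f, cls f ∈ 𝒮 := by
      obtain ⟨i, hi⟩ := hne
      exact ⟨rep i, by rw [hcls_rep_eq]; exact hi⟩
    have h := del_row_classes n G A c m ↥L cls 𝒮 (rep l) ⟨hfin, hdisj, hc0, hgen, hco⟩ hPoly hTF hcls_iff hl' hne' hIH
    have hvS : (∑ i ∈ 𝒮, (volume (⋃ f ∈ Finset.univ.filter (fun f => cls f = i), G f)).toReal) = ∑ i ∈ 𝒮, v i := by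
      simp only [hvdef]
    have hFS : (∑ i ∈ 𝒮, (∑ f ∈ Finset.univ.filter (fun f => cls f = i),
        (Per (W (A f)) (G f) - ∑ g, (if f = g then 0 else ι (W (A f)) (G f) (G g))))) = ∑ i ∈ 𝒮, F i := by
      simp only [hFdef]
      refine Finset.sum_congr rfl fun i _ => Finset.sum_congr rfl fun f _ => ?_
      rw [hWcls f]; rfl
    have hXS : (∑ i ∈ Finset.univ \ 𝒮, ∑ j ∈ 𝒮, (∑ f ∈ Finset.univ.filter (fun f => cls f = i),
        ∑ g ∈ Finset.univ.filter (fun g => cls g = j),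
          (Per (Metric.closedBall (0 : EuclideanSpace ℝ (Fin 3)) 1) (G f) +
            Per (Metric.closedBall (0 : EuclideanSpace ℝ (Fin 3)) 1) (G g) -
            Per (Metric.closedBall (0 : EuclideanSpace ℝ (Fin 3)) 1) (G f ∪ G g)) / 2)) =
        ∑ i ∈ Finset.univ \ 𝒮, ∑ j ∈ 𝒮, Acl i j := by
      simp only [hAcldef]; rfl
    have hAS : (∑ i, ∑ j, (if ((i ∈ 𝒮) ∧ (j ∈ 𝒮)) ∧ i ≠ j then
        (∑ f ∈ Finset.univ.filter (fun f => cls f = i), ∑ g ∈ Finset.univ.filter (fun g => cls g = j),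
          (Per (Metric.closedBall (0 : EuclideanSpace ℝ (Fin 3)) 1) (G f) +
            Per (Metric.closedBall (0 : EuclideanSpace ℝ (Fin 3)) 1) (G g) -
            Per (Metric.closedBall (0 : EuclideanSpace ℝ (Fin 3)) 1) (G f ∪ G g)) / 2) / 2 else 0)) =
        ∑ i, ∑ j, (if ((i ∈ 𝒮) ∧ (j ∈ 𝒮)) ∧ i ≠ j then Acl i j / 2 else 0) := by
      simp only [hAcldef]; rfl
    rw [hvS, hFS, hXS, hAS] at h
    exact h
  exact aggLP_bound hC F Y Acl v (Vol n G) (En n G A c m) hab hbd had hVpos hv_nn hvdb hvba hdom' htop hF_nn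
    hY_nn hAcl_symm hfloor hshv_single hshv_pair hsingle0 hpair0 htriple0 hballP hisoP hsumP hsumP0
    hT hVsplit hAcl_nn hE hrec hdel

/-- **All twin-free polyhedral textures, modulo CH-P3 and CH-P1′ (by name).**  Every twin-free polyhedral
texture — any number of grains, any number of lattice classes — satisfies the polycrystal Wulff bound
`6·2^{1/3}(√2·Vol)^{2/3} ≤ En`, given the aggregated LP certificate `AggCert27_8` and the Wulff pair-overlap
constant `WulffOverlap27_8`. -/
theorem rung_twinFree_allClasses_of_AggCert (hC : AggCert27_8) (hCH : WulffOverlap27_8) :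

    let Λ : Set (EuclideanSpace ℝ (Fin 3)) := Literature.MathematicalPhysics.StatisticalMechanics.fccStacking 1 (Real.sqrt (2 / 3));
    let Brl : (ℤ → ℤ) → Set (EuclideanSpace ℝ (Fin 3)) := Literature.MathematicalPhysics.StatisticalMechanics.barlowStacking 1 (Real.sqrt (2 / 3));
    let Ax : EuclideanSpace ℝ (Fin 3) → (EuclideanSpace ℝ (Fin 3) ≃ₗᵢ[ℝ] EuclideanSpace ℝ (Fin 3)) → (EuclideanSpace ℝ (Fin 3) ≃ₗᵢ[ℝ] EuclideanSpace ℝ (Fin 3)) → Prop := fun m A B => ∃ (L : EuclideanSpace ℝ (Fin 3) ≃ₗᵢ[ℝ] EuclideanSpace ℝ (Fin 3)) (s₁ s₂ : EuclideanSpace ℝ (Fin 3)) (σ σ' : ℤ → ℤ), Literature.MathematicalPhysics.StatisticalMechanics.IsHaggSeq σ ∧ Literature.MathematicalPhysics.StatisticalMechanics.IsHaggSeq σ' ∧ L (EuclideanSpace.single (2 : Fin 3) (1 : ℝ)) = m ∧ A '' Λ ⊆ (fun q => L q + s₁) '' Brl σ ∧ B '' Λ ⊆ (fun q => L q + s₂)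 '' Brl σ';
    let CoAx : (EuclideanSpace ℝ (Fin 3) ≃ₗᵢ[ℝ] EuclideanSpace ℝ (Fin 3)) → (EuclideanSpace ℝ (Fin 3) ≃ₗᵢ[ℝ] EuclideanSpace ℝ (Fin 3)) → Prop := fun A B => ∃ m, Ax m A B;
    let Φ : EuclideanSpace ℝ (Fin 3) → ℝ := fun ν => Real.sqrt 2 / 4 * ∑ᶠ w ∈ {w ∈ Λ | ‖w‖ = 1}, |⟪w, ν⟫_ℝ|;
    let Per : Set (EuclideanSpace ℝ (Fin 3)) → Set (EuclideanSpace ℝ (Fin 3)) → ℝ := fun K S => (⨆ (ξ : EuclideanSpace ℝ (Fin 3) → EuclideanSpace ℝ (Fin 3)) (_ : ContDiff ℝ 1 ξ ∧ HasCompactSupport ξ ∧ ∀ z, ξ z ∈ K), ENNReal.ofReal (∫ z in S, Literature.MathematicalPhysics.StatisticalMechanics.fieldDivergence ξ z)).toReal;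
    let ι : Set (EuclideanSpace ℝ (Fin 3)) → Set (EuclideanSpace ℝ (Fin 3)) → Set (EuclideanSpace ℝ (Fin 3)) → ℝ := fun K S₁ S₂ => (Per K S₁ + Per K S₂ - Per K (S₁ ∪ S₂)) / 2;
    let W : (EuclideanSpace ℝ (Fin 3) ≃ₗᵢ[ℝ] EuclideanSpace ℝ (Fin 3)) → Set (EuclideanSpace ℝ (Fin 3)) := fun A => {y | ∀ ν : EuclideanSpace ℝ (Fin 3), ⟪y, ν⟫_ℝ ≤ Φ (A.symm ν)};
    let Dsc : EuclideanSpace ℝ (Fin 3) → Set (EuclideanSpace ℝ (Fin 3)) := fun m => {y | ‖y‖ ≤ 1 ∧ ⟪y, m⟫_ℝ = 0};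
    let Tex : (n : ℕ) → (Fin n → Set (EuclideanSpace ℝ (Fin 3))) → (Fin n → (EuclideanSpace ℝ (Fin 3) ≃ₗᵢ[ℝ] EuclideanSpace ℝ (Fin 3))) → (Fin n → Fin n → ℝ) → (Fin n → Fin n → EuclideanSpace ℝ (Fin 3)) → Prop := fun n G A c m => (∀ f : Fin n, Literature.MathematicalPhysics.StatisticalMechanics.HasFinitePerimeter (G f) ∧ volume (G f) < ⊤) ∧ (∀ f g, f ≠ g → Disjoint (G f) (G g)) ∧ (∀ f g, f ≠ g → 0 ≤ c f g) ∧ (∀ f g, f ≠ g → ¬ CoAx (A f) (A g) → m f g = 0 ∧ 1 ≤ c f g) ∧ (∀ f g, f ≠ g → CoAx (A f) (A g) → A f '' Λ ≠ A g '' Λ → Ax (m f g) (A f) (A g) ∧ 1 / 2 ≤ c f g);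
    let En : (n : ℕ) → (Fin n → Set (EuclideanSpace ℝ (Fin 3))) → (Fin n → (EuclideanSpace ℝ (Fin 3) ≃ₗᵢ[ℝ] EuclideanSpace ℝ (Fin 3))) → (Fin n → Fin n → ℝ) → (Fin n → Fin n → EuclideanSpace ℝ (Fin 3)) → ℝ := fun n G A c m => ∑ f : Fin n, Per (W (A f)) (G f) - ∑ f, ∑ g, (if f = g then 0 else ι (W (A f)) (G f) (G g)) + ∑ f, ∑ g, (if f = g then 0 else c f g / 2 * ι (Dsc (m f g)) (G f) (G g));
    let Vol : (n : ℕ) → (Fin n → Set (EuclideanSpace ℝ (Fin 3))) → ℝ := fun n G => (volume (⋃ f : Fin n, G f)).toReal;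
    let Poly : Set (EuclideanSpace ℝ (Fin 3)) → Prop := fun S => ∃ (k : ℕ) (H : Fin k → Finset ((EuclideanSpace ℝ (Fin 3)) × ℝ)), S = ⋃ i, ⋂ p ∈ H i, {x | ⟪p.1, x⟫_ℝ < p.2};
    let TF : (n : ℕ) → (Fin n → (EuclideanSpace ℝ (Fin 3) ≃ₗᵢ[ℝ] EuclideanSpace ℝ (Fin 3))) → Prop := fun n A => ∀ f g : Fin n, f ≠ g → CoAx (A f) (A g) → A f '' Λ = A g '' Λ;
    ∀ (n : ℕ) (G : Fin n → Set (EuclideanSpace ℝ (Fin 3))) (A : Fin n → (EuclideanSpace ℝ (Fin 3) ≃ₗᵢ[ℝ] EuclideanSpace ℝ (Fin 3))) (c : Fin n → Fin n → ℝ) (m : Fin n → Fin n → EuclideanSpace ℝ (Fin 3)),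
        Tex n G A c m → (∀ f, Poly (G f)) → TF n A → 6 * (2 : ℝ) ^ ((1 : ℝ) / 3) * (Real.sqrt 2 * Vol n G) ^ ((2 : ℝ) / 3) ≤ En n G A c m := by
  intro Λ Brl Ax CoAx Φ Per ι W Dsc Tex En Vol Poly TF n G A c m hTex hPoly hTF
  exact rung_twinFree_allClasses_of_step hCH (aggStep_of_AggCert hC hCH) n G A c m hTex hPoly hTF

end Summit.Ventures.Crystal3D.Cruxes.PolycrystalWulffBound.PolyDensity

end
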